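import Literature.RingTheory.TightClosure.TightClosure
import Mathlib.RingTheory.MvPolynomial.Basic
import Mathlib.RingTheory.Ideal.Quotient.Operations
import Mathlib.RingTheory.Ideal.Maps
import Mathlib.Algebra.CharP.Algebra
import Mathlib.Algebra.CharP.Quotient
import Mathlib.Algebra.MvPolynomial.Eval
import HarnessLib

/-!
# (C3a) THE RESIDUE-POINT DICTIONARY: Fedder's test at the tautological point `⇒ g^{p-1} ∉ P^{[p]}`
# (crux `FInjectiveMacaulayfication`, CN engine in global form — CRUX-PLAN v6 §1.3 piece (C3a), statement of
# `L/w45a/CNEngineSig.lean` §(C3a) CORRECTED by the hypothesis `[CharP k p]`, without which it is false: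
# `k = ℚ, p = 2, P = (y₀,y₁), g = y₀y₁`, where `2·y₀y₁ = (y₀+y₁)² − y₀² − y₁² ∈ P^{[2]}`)

Support file for crux stmt-ResolutionOfSingularities-15315 (`FrobeniusLadder.FInjectiveMacaulayfication`), chain w45a,
seat res-L1-w45a-stub-3 (idle-seat pickup of stub-4's piece, announced on STATUS). [OURS · L1 W4.5a] — NOT a statement of the
manuscript; AI-written, weaker than expert review.

For a maximal ideal `P` of `k[y] = MvPolynomial (Fin n) k` with residue field `K = k[y]/P` and tautological point `a = (ȳᵢ)`:

* `sub_C_eval_mem_span_X_sub_C` — Taylor at a point: `q − C (eval a q) ∈ (yᵢ − aᵢ)` for every `q ∈ K[y]` (any comm. ring `K`);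
* `map_mem_span_X_sub_C` — the coefficient extension `k[y] → K[y]` maps `P` into `𝔫_a = (yᵢ − aᵢ)` (`eval_a ∘ map = mk_P`);
* `map_frobeniusPower_le` — hence it maps `P^{[p]}` into `𝔫_a^{[p]} = ((yᵢ − aᵢ)^p)` (characteristic `p`: `frobeniusPower_span`);
* `frobeniusPower_of_fedderAt` — **(C3a)**: if `(g ⊗ K)^{p−1} ∉ ((yᵢ − aᵢ)^p)` (Fedder's test for `g` at `a`, the shape
  `ToricChartFedderAssembly.toricChart_fedder` delivers) then `g^{p−1} ∉ frobeniusPower p P`.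

No definitions, no named facts; glue on Mathlib + `Literature.RingTheory.TightClosure` (`frobeniusPower`). [folklore]
-/

-- single-problem summit: the doubled namespace component is forced
set_option linter.dupNamespace false

noncomputable section

namespace Summit.ResolutionOfSingularities.ResolutionOfSingularities.Theorems.FInjectiveMacaulayfication.FrobeniusPowerOfFedderAt

open Literature.RingTheory.TightClosure

/-- **Taylor at a point**: `q − C (q(a)) ∈ (yᵢ − aᵢ)`. [folklore] -/
theorem sub_C_eval_mem_span_X_sub_C {K : Type} [CommRing K] {n : ℕ} (a : Fin n → K) (q : MvPolynomial (Fin n) K) :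
    q - MvPolynomial.C (MvPolynomial.eval a q) ∈
      Ideal.span (Set.range fun i : Fin n => (MvPolynomial.X i - MvPolynomial.C (a i) : MvPolynomial (Fin n) K)) := by
  induction q using MvPolynomial.induction_on with
  | C r =>
    rw [MvPolynomial.eval_C, sub_self]
    exact Ideal.zero_mem _
  | add f g hf hg =>
    have e : f + g - MvPolynomial.C (MvPolynomial.eval a (f + g)) =
        (f - MvPolynomial.C (MvPolynomial.eval a f)) + (g - MvPolynomial.C (MvPolynomial.eval a g)) := by
      rw [map_add, map_add]; ring
    rw [e]
    exact Ideal.add_mem _ hf hg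
  | mul_X f i hf =>
    have e : f * MvPolynomial.X i - MvPolynomial.C (MvPolynomial.eval a (f * MvPolynomial.X i)) =
        (f - MvPolynomial.C (MvPolynomial.eval a f)) * MvPolynomial.X i +
          MvPolynomial.C (MvPolynomial.eval a f) * (MvPolynomial.X i - MvPolynomial.C (a i)) := by
      rw [map_mul, MvPolynomial.eval_X, map_mul]; ring
    rw [e]
    exact Ideal.add_mem _ (Ideal.mul_mem_right _ _ hf) (Ideal.mul_mem_left _ _ (Ideal.subset_span ⟨i, rfl⟩))

/-- **The coefficient extension `k[y] → (k[y]/P)[y]` maps `P` into the point ideal `(yᵢ − ȳᵢ)`.** [folklore] -/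
theorem map_mem_span_X_sub_C {k : Type} [Field k] {n : ℕ} (P : Ideal (MvPolynomial (Fin n) k)) {h : MvPolynomial (Fin n) k}
    (hh : h ∈ P) :
    MvPolynomial.map (algebraMap k (MvPolynomial (Fin n) k ⧸ P)) h ∈
      Ideal.span (Set.range fun i : Fin n =>
        (MvPolynomial.X i - MvPolynomial.C (Ideal.Quotient.mk P (MvPolynomial.X i)) :
          MvPolynomial (Fin n) (MvPolynomial (Fin n) k ⧸ P))) := by
  -- `eval_a ∘ map = mk_P`
  have hcomp : (MvPolynomial.eval fun i : Fin n => Ideal.Quotient.mk P (MvPolynomial.X i)).comp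
      (MvPolynomial.map (algebraMap k (MvPolynomial (Fin n) k ⧸ P))) = Ideal.Quotient.mk P := by
    refine MvPolynomial.ringHom_ext (fun r => ?_) (fun i => ?_)
    · rw [RingHom.comp_apply, MvPolynomial.map_C, MvPolynomial.eval_C,
        IsScalarTower.algebraMap_apply k (MvPolynomial (Fin n) k) (MvPolynomial (Fin n) k ⧸ P), Ideal.Quotient.algebraMap_eq,
        MvPolynomial.algebraMap_eq]
    · rw [RingHom.comp_apply, MvPolynomial.map_X, MvPolynomial.eval_X]
  have hev : MvPolynomial.eval (fun i : Fin n => Ideal.Quotient.mk P (MvPolynomial.X i))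
      (MvPolynomial.map (algebraMap k (MvPolynomial (Fin n) k ⧸ P)) h) = 0 := by
    rw [← RingHom.comp_apply, hcomp, Ideal.Quotient.eq_zero_iff_mem]
    exact hh
  have h1 := sub_C_eval_mem_span_X_sub_C (fun i : Fin n => Ideal.Quotient.mk P (MvPolynomial.X i))
    (MvPolynomial.map (algebraMap k (MvPolynomial (Fin n) k ⧸ P)) h)
  rwa [hev, map_zero, sub_zero] at h1

/-- **`P^{[p]}` extends into `((yᵢ − ȳᵢ)^p)`** (characteristic `p`). [folklore] -/
theorem map_frobeniusPower_le (p : ℕ) [Fact p.Prime] {k : Type} [Field k] [CharP k p] {n : ℕ}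
    (P : Ideal (MvPolynomial (Fin n) k)) [P.IsMaximal] :
    (frobeniusPower p P).map (MvPolynomial.map (algebraMap k (MvPolynomial (Fin n) k ⧸ P))) ≤
      Ideal.span (Set.range fun i : Fin n =>
        (MvPolynomial.X i - MvPolynomial.C (Ideal.Quotient.mk P (MvPolynomial.X i))) ^ p) := by
  haveI : CharP (MvPolynomial (Fin n) k ⧸ P) p :=
    charP_of_injective_algebraMap (algebraMap k (MvPolynomial (Fin n) k ⧸ P)).injective p
  haveI : CharP (MvPolynomial (Fin n) (MvPolynomial (Fin n) k ⧸ P)) p :=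
    charP_of_injective_algebraMap (MvPolynomial.C_injective (Fin n) (MvPolynomial (Fin n) k ⧸ P)) p
  rw [frobeniusPower_def, Ideal.map_span, Ideal.span_le]
  rintro _ ⟨_, ⟨h, hh, rfl⟩, rfl⟩
  rw [SetLike.mem_coe, map_pow]
  -- `(map h)^p ∈ 𝔫_a^{[p]} = ((yᵢ − aᵢ)^p)`
  have h1 : MvPolynomial.map (algebraMap k (MvPolynomial (Fin n) k ⧸ P)) h ^ p ∈
      frobeniusPower p (Ideal.span (Set.range fun i : Fin n =>
        (MvPolynomial.X i - MvPolynomial.C (Ideal.Quotient.mk P (MvPolynomial.X i)) :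
          MvPolynomial (Fin n) (MvPolynomial (Fin n) k ⧸ P)))) :=
    pow_mem_frobeniusPower (map_mem_span_X_sub_C P hh)
  have h2 := frobeniusPower_span (R := MvPolynomial (Fin n) (MvPolynomial (Fin n) k ⧸ P)) p 1
    (Set.range fun i : Fin n =>
      (MvPolynomial.X i - MvPolynomial.C (Ideal.Quotient.mk P (MvPolynomial.X i)) :
        MvPolynomial (Fin n) (MvPolynomial (Fin n) k ⧸ P)))
  rw [pow_one, ← Set.range_comp] at h2
  rw [h2] at h1
  exact h1

/-- **(C3a) THE RESIDUE-POINT DICTIONARY** (statement of `CNEngineSig.stub_frobeniusPower_of_fedderAt` with the necessary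
`[CharP k p]` added): for a maximal ideal `P` of `k[y]` with residue field `K = k[y]/P` and tautological point `a = (ȳᵢ)`,
Fedder's test for `g ⊗ K` at `a` implies `g^(p-1) ∉ P^[p]`. [folklore] -/
theorem frobeniusPower_of_fedderAt : ∀ (p : ℕ) [Fact p.Prime] (k : Type) [Field k] [CharP k p] (n : ℕ)
    (g : MvPolynomial (Fin n) k) (P : Ideal (MvPolynomial (Fin n) k)) [P.IsMaximal],
    (MvPolynomial.map (algebraMap k (MvPolynomial (Fin n) k ⧸ P)) g) ^ (p - 1) ∉
      Ideal.span (Set.range fun i : Fin n =>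
        (MvPolynomial.X i - MvPolynomial.C (Ideal.Quotient.mk P (MvPolynomial.X i))) ^ p) →
    g ^ (p - 1) ∉ frobeniusPower p P := by
  intro p _ k _ _ n g P _ hfed hmem
  apply hfed
  rw [← map_pow]
  exact map_frobeniusPower_le p P (Ideal.mem_map_of_mem _ hmem)

end Summit.ResolutionOfSingularities.ResolutionOfSingularities.Theorems.FInjectiveMacaulayfication.FrobeniusPowerOfFedderAt

end
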